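import Literature.AlgebraicGeometry.Morphisms.CohAffineExactness
import Mathlib.CategoryTheory.Functor.OfSequence
import Mathlib.Algebra.Module.Torsion.Basic
import HarnessLib

/-!
# Coherent formal modules in the quotient model: towers `(F_n)_n` with `F_{n+1}/aⁿ⁺¹F_{n+1} = F_n`

Görtz–Wedhorn, *Algebraic Geometry II* (2023), Def. 24.85 and (24.18.1) (pp. 561–562): for a closed
subscheme `Z = V(a)` of a scheme `X` cut out by ONE global function `a ∈ Γ(X, 𝒪_X)` (the case of the
tree's `p`-adic applications, `a = p` on a `W(k)`-scheme), a coherent `𝒪_{X/Z}`-module "is" a tower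
`(F_n)_{n ≥ 0}` of coherent `𝒪_X`-modules with `aⁿ⁺¹F_n = 0` and transition maps identifying `F_n`
with `F_{n+1}/aⁿ⁺¹F_{n+1}`. We encode towers as functors `F : ℕᵒᵖ ⥤ Mod(𝒪_X)` (so that ALL iterated
transition maps `F_m → F_n`, `n ≤ m`, are available by functoriality) and the conditions as a
`Prop`-valued structure:

* `towerπ F n : F_{n+1} → F_n` — the successive transition map;
* `IsFormalTower a F` — `aⁿ⁺¹` kills `F_n`; `towerπ F n` is an epimorphism; and
  `F_{n+1} —aⁿ⁺¹→ F_{n+1} —π→ F_n` is exact (i.e. `F_n = F_{n+1}/aⁿ⁺¹F_{n+1}`);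
* `IsFormalTower.ofIsos` — the tower attached to modules `M_n` and isomorphisms
  `coker(aⁿ⁺¹ : M_{n+1} → M_{n+1}) ≅ M_n` (the shape in which such data usually arises);
* sections over an AFFINE open `V` of a tower of COHERENT modules (`X` locally noetherian):
  `aⁿ⁺¹|_V = resTop X V a ^ (n+1)` kills `Γ(V, F_n)` (`pow_smul_app_eq_zero`, `isTorsionBySet_app`), the transition maps are
  surjective on `V`-sections (`app_towerπ_surjective`) with kernel `aⁿ⁺¹Γ(V, F_{n+1})`
  (`ker_appLinear_towerπ`) — i.e. `(Γ(V, F_n))_n` is a tower of `Γ(V, 𝒪_X)/aⁿ⁺¹`-modules of the kind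
  studied in `RingTheory/AdicTopology/AdicTowerCompletedLimit` and `…/AdicTowerKernel`
  (GW Prop. 24.88, Cor. 24.90).

Morphisms of towers are natural transformations. Everything is proved; no named facts.

## References

* U. Görtz, T. Wedhorn, *Algebraic Geometry II: Cohomology of Schemes*, Springer Spektrum (2023),
  Def. 24.85, (24.18.1), Prop. 24.88 (pp. 561–562). [GortzWedhorn2023]
* A. Grothendieck, EGA III₁ (1961), §5.1. [EGAIII1]
-/

noncomputable section

open CategoryTheory AlgebraicGeometry Limits TopologicalSpace Opposite
open Literature.AlgebraicGeometry.Modules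

universe u

namespace Literature.AlgebraicGeometry.Morphisms

variable {X : Scheme.{u}} (a : Γ(X, ⊤))

/-! ### Towers and the quotient-model conditions -/

/-- The successive transition map `F_{n+1} → F_n` of a tower `F : ℕᵒᵖ ⥤ Mod(𝒪_X)`. [folklore] -/
abbrev towerπ (F : ℕᵒᵖ ⥤ X.Modules) (n : ℕ) : F.obj ⟨n + 1⟩ ⟶ F.obj ⟨n⟩ :=
  F.map (homOfLE (Nat.le_succ n)).op

/-- If `x` kills `F_n`, then `F_{n+1} —x→ F_{n+1} → F_n` composes to zero. [folklore] -/
theorem globalScalar_comp_towerπ (F : ℕᵒᵖ ⥤ X.Modules) (n : ℕ) (x : Γ(X, ⊤))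
    (hk : globalScalar (F.obj ⟨n⟩) x = 0) : globalScalar (F.obj ⟨n + 1⟩) x ≫ towerπ F n = 0 := by
  rw [globalScalar_comp, hk, comp_zero]

/-- **Coherent formal modules in the quotient model** (minus coherence, which is kept as a separate
hypothesis `∀ n, Coh (F_n)`): a tower `F : ℕᵒᵖ ⥤ Mod(𝒪_X)` such that `aⁿ⁺¹F_n = 0`, each transition
`F_{n+1} → F_n` is an epimorphism, and `F_{n+1} —aⁿ⁺¹→ F_{n+1} → F_n` is exact, i.e.
`F_n = F_{n+1}/aⁿ⁺¹F_{n+1}`. [cite: GortzWedhorn2023, Def. 24.85 and (24.18.1) (pp. 561–562)] -/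
structure IsFormalTower (F : ℕᵒᵖ ⥤ X.Modules) : Prop where
  /-- `aⁿ⁺¹ F_n = 0` -/
  killed : ∀ n, globalScalar (F.obj ⟨n⟩) (a ^ (n + 1)) = 0
  /-- the transition maps are epimorphisms -/
  epi : ∀ n, Epi (towerπ F n)
  /-- `F_{n+1} —aⁿ⁺¹→ F_{n+1} → F_n` is exact -/
  exact : ∀ n, (ShortComplex.mk (globalScalar (F.obj ⟨n + 1⟩) (a ^ (n + 1))) (towerπ F n)
    (globalScalar_comp_towerπ F n _ (killed n))).Exact

namespace IsFormalTower

variable {a} {F : ℕᵒᵖ ⥤ X.Modules} (hF : IsFormalTower a F)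
include hF

/-- `aᵐ⁺¹` kills `F_n` for `n ≤ m`. [folklore] -/
theorem killed_of_le {n m : ℕ} (h : n ≤ m) : globalScalar (F.obj ⟨n⟩) (a ^ (m + 1)) = 0 := by
  obtain ⟨d, rfl⟩ := Nat.exists_eq_add_of_le h
  rw [show a ^ (n + d + 1) = a ^ d * a ^ (n + 1) by ring, globalScalar_mul, hF.killed n, zero_comp]

/-- All iterated transition maps `F_m → F_n` (`n ≤ m`) are epimorphisms. [folklore] -/
theorem epi_map {n m : ℕ} (h : n ≤ m) : Epi (F.map (homOfLE h).op) := by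
  obtain ⟨d, rfl⟩ := Nat.exists_eq_add_of_le h
  induction d with
  | zero =>
    change Epi (F.map (𝟙 (⟨n⟩ : ℕᵒᵖ)))
    rw [F.map_id]
    infer_instance
  | succ d ih =>
    have h' : n ≤ n + d := Nat.le_add_right n d
    have : (homOfLE h).op = (homOfLE (Nat.le_succ (n + d))).op ≫ (homOfLE h').op := Subsingleton.elim _ _
    rw [this, F.map_comp]
    haveI := ih h'
    haveI := hF.epi (n + d)
    exact epi_comp _ _

end IsFormalTower

/-! ### Towers from modules and isomorphisms `M_{n+1}/aⁿ⁺¹M_{n+1} ≅ M_n` -/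

section OfIsos

variable (M : ℕ → X.Modules)
  (β : ∀ n, cokernel (globalScalar (M (n + 1)) (a ^ (n + 1))) ≅ M n)

/-- The tower attached to modules `M_n` and isomorphisms `coker(aⁿ⁺¹ on M_{n+1}) ≅ M_n`: transition
maps `M_{n+1} → coker → M_n`. [cite: GortzWedhorn2023, (24.18.1) (p. 562)] -/
def towerOfIsos : ℕᵒᵖ ⥤ X.Modules :=
  Functor.ofOpSequence (X := M) fun n => cokernel.π _ ≫ (β n).hom

/-- The levels of `towerOfIsos` are the `M_n`. [folklore] -/
@[simp]
theorem towerOfIsos_obj (n : ℕ) : (towerOfIsos a M β).obj ⟨n⟩ = M n := rfl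

/-- The transition maps of `towerOfIsos`. [folklore] -/
theorem towerπ_towerOfIsos (n : ℕ) :
    towerπ (towerOfIsos a M β) n = cokernel.π _ ≫ (β n).hom :=
  Functor.ofOpSequence_map_homOfLE_succ _ n

/-- **`towerOfIsos` is a formal tower** as soon as `aⁿ⁺¹M_n = 0`.
[cite: GortzWedhorn2023, (24.18.1) (p. 562)] -/
theorem IsFormalTower.ofIsos (hk : ∀ n, globalScalar (M n) (a ^ (n + 1)) = 0) :
    IsFormalTower a (towerOfIsos a M β) where
  killed := hk
  epi n := by rw [towerπ_towerOfIsos]; exact epi_comp (cokernel.π _) (β n).hom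
  exact n := by
    let S₁ := ShortComplex.mk (globalScalar (M (n + 1)) (a ^ (n + 1))) (cokernel.π _)
      (cokernel.condition _)
    let S₂ := ShortComplex.mk (globalScalar ((towerOfIsos a M β).obj ⟨n + 1⟩) (a ^ (n + 1)))
      (towerπ (towerOfIsos a M β) n) (globalScalar_comp_towerπ _ n _ (hk n))
    have e : S₁.Exact := ShortComplex.exact_cokernel _
    let φ : S₁ ⟶ S₂ :=
      { τ₁ := 𝟙 (M (n + 1))
        τ₂ := 𝟙 (M (n + 1))
        τ₃ := (β n).hom
        comm₁₂ := by
          change 𝟙 _ ≫ globalScalar (M (n + 1)) (a ^ (n + 1)) =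
            globalScalar (M (n + 1)) (a ^ (n + 1)) ≫ 𝟙 _
          rw [Category.id_comp, Category.comp_id]
        comm₂₃ := by
          change 𝟙 _ ≫ towerπ (towerOfIsos a M β) n = cokernel.π _ ≫ (β n).hom
          rw [Category.id_comp, towerπ_towerOfIsos] }
    haveI : Epi φ.τ₁ := by change Epi (𝟙 _); infer_instance
    haveI : IsIso φ.τ₂ := by change IsIso (𝟙 _); infer_instance
    haveI : Mono φ.τ₃ := by change Mono (β n).hom; infer_instance
    exact (ShortComplex.exact_iff_of_epi_of_isIso_of_mono φ).mp e

end OfIsos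

/-! ### Sections over affine opens -/

section Sections

variable {a} {F : ℕᵒᵖ ⥤ X.Modules} (hF : IsFormalTower a F) (V : X.Opens)

include hF in
/-- `aⁿ⁺¹|_V` kills `Γ(V, F_n)`. [cite: GortzWedhorn2023, (24.18.1) (p. 562)] -/
theorem IsFormalTower.pow_smul_app_eq_zero (n : ℕ) (m : Γ(F.obj ⟨n⟩, V)) :
    resTop X V a ^ (n + 1) • m = 0 := by
  have h := congrArg (fun φ => φ.app V m) (hF.killed n)
  dsimp only at h
  rw [globalScalar_app_apply, map_pow] at h
  exact h

include hF in
/-- `Γ(V, F_n)` is an `(aⁿ⁺¹)`-torsion `Γ(V, 𝒪_X)`-module. [folklore] -/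
theorem IsFormalTower.isTorsionBySet_app (n : ℕ) :
    Module.IsTorsionBySet Γ(X, V) Γ(F.obj ⟨n⟩, V)
      ((Ideal.span {resTop X V a} ^ (n + 1) : Ideal Γ(X, V)) : Set Γ(X, V)) := by
  rintro m ⟨c, hc⟩
  change c • m = 0
  have hc' : c ∈ Ideal.span {resTop X V a ^ (n + 1)} := by rwa [← Ideal.span_singleton_pow]
  obtain ⟨d, rfl⟩ := Ideal.mem_span_singleton'.mp hc'
  rw [mul_smul, hF.pow_smul_app_eq_zero V n m, smul_zero]

variable (hcoh : ∀ n, Coh (F.obj ⟨n⟩)) (hV : IsAffineOpen V)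

include hF hcoh hV in
/-- **The transition maps are surjective on sections over affine opens.**
[cite: GortzWedhorn2023, Prop. 24.88 (p. 562)] -/
theorem IsFormalTower.app_towerπ_surjective (n : ℕ) : Function.Surjective ((towerπ F n).app V) :=
  haveI := hF.epi n
  app_surjective_of_epi _ (hcoh (n + 1)).loc (hcoh n).loc hV

include hF hcoh hV in
/-- **The kernel of `Γ(V, F_{n+1}) → Γ(V, F_n)` is `aⁿ⁺¹Γ(V, F_{n+1})`** for `V` affine.
[cite: GortzWedhorn2023, Prop. 24.88 (p. 562)] -/
theorem IsFormalTower.ker_appLinear_towerπ [IsLocallyNoetherian X] (n : ℕ) :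
    LinearMap.ker (appLinear (towerπ F n) V) =
      Ideal.span {resTop X V a} ^ (n + 1) • (⊤ : Submodule Γ(X, V) Γ(F.obj ⟨n + 1⟩, V)) := by
  haveI := hF.epi n
  have h := (app_surjective_and_ker_of_exact_of_epi (a ^ (n + 1)) (towerπ F n)
    (globalScalar_comp_towerπ F n _ (hF.killed n)) (hF.exact n) (hcoh (n + 1)) (hcoh n) hV).2
  ext y
  rw [LinearMap.mem_ker, Ideal.span_singleton_pow, Submodule.ideal_span_singleton_smul,
    Submodule.mem_smul_pointwise_iff_exists]
  change (towerπ F n).app V y = 0 ↔ _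
  rw [h y]
  simp only [map_pow, Submodule.mem_top, true_and]

include hcoh hV in
/-- `Γ(V, F_0)` is a finitely generated `Γ(V, 𝒪_X)`-module. [folklore] -/
theorem moduleFinite_app_zero : Module.Finite Γ(X, V) Γ(F.obj ⟨0⟩, V) := (hcoh 0).ft hV

end Sections

/-! ### Morphisms of towers on sections -/

section Morphisms

variable {F G : ℕᵒᵖ ⥤ X.Modules} (u : F ⟶ G) (V : X.Opens)

/-- Naturality of `u` with respect to the transition maps. [folklore] -/
@[reassoc]
theorem towerπ_naturality (n : ℕ) : u.app ⟨n + 1⟩ ≫ towerπ G n = towerπ F n ≫ u.app ⟨n⟩ :=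
  (u.naturality _).symm

/-- Naturality on sections: `π_G (u_{n+1} x) = u_n (π_F x)`. [folklore] -/
theorem appLinear_towerπ_comp (n : ℕ) :
    appLinear (towerπ G n) V ∘ₗ appLinear (u.app ⟨n + 1⟩) V =
      appLinear (u.app ⟨n⟩) V ∘ₗ appLinear (towerπ F n) V := by
  ext x
  change (u.app ⟨n + 1⟩ ≫ towerπ G n).app V x = (towerπ F n ≫ u.app ⟨n⟩).app V x
  rw [towerπ_naturality]

/-- A levelwise epimorphism between towers of coherent modules is surjective on sections over
affine opens. [cite: Hartshorne1977, II Prop. 5.6 (p. 113)] -/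
theorem app_surjective_of_levelwise_epi (hFc : ∀ n, Coh (F.obj ⟨n⟩)) (hGc : ∀ n, Coh (G.obj ⟨n⟩))
    (hu : ∀ n, Epi (u.app ⟨n⟩)) (hV : IsAffineOpen V) (n : ℕ) :
    Function.Surjective (appLinear (u.app ⟨n⟩) V) :=
  haveI := hu n
  app_surjective_of_epi _ (hFc n).loc (hGc n).loc hV

end Morphisms

end Literature.AlgebraicGeometry.Morphisms

end
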